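import Summits.AtomisticToContinuum.Crystallization.Theorems.ChartedZeroExcessLayeredLatticeLiouvilleUJ

/-!
# Zero-excess layered lattice Liouville — part UK (lens-2 g52, node «BondIsoThreading» II/III): the Gehring glue `[Cᵇ] ∧ leaf ⇒ (M♭ᵇ)₀ ⇒ (Mᵇ)` and the
# tame-window twins [Tᵇ] `TameWindowBPG`, [T_bᵇ] `BareTameWindowBPG` with the cut `[Tᵇ] ⟸ [I_D] ∧ [T_bᵇ]` (PROVED)

Continuation of part UJ (insertion rule, reason and tags: module docstrings of parts UI, UJ).  Contents:
§ZK.1 the generic glue of line `_16XH19B(_tol)` re-proved with the clause handed to [Cᵇ]: `[Cᵇ] ∧ (local counting Gehring lemma) ⇒ (M♭ᵇ)₀` (part UB's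
proof VERBATIM — the piece is instantiated ONCE, at the given bond-isomorphic `Ψ`) and `[Cᵇ] ∧ leaf ⇒ (Mᵇ)` (`aHi ≤ 8/7`, through part UJ's dictionary);
record examples at `(1; 2, 1/16, 1/50)`, including «the OLD residual [C] still closes the new leaf (Mᵇ)».
§ZK.2 [Tᵇ] / [T_bᵇ]: [T] `TameWindowPG` (part UC) and the [T]-side residual of record [T_b] `BareTameWindowPG` (part UG) with `IsBondIso S Ψ →` inserted;
`[T] ⇒ [Tᵇ]`, `[T_b] ⇒ [T_bᵇ]`, `[Tᵇ] ⇒ [T_bᵇ]`; seams `[D_w] ∧ [T_bᵇ] ⇒ [Tᵇ]` (part UG's `em` on `IsDressed`), `[I_D] ∧ [T_bᵇ] ⇒ [Tᵇ]`, `[CG] ∧ [T_bᵇ] ⇒ [Tᵇ]`.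
Under the clause the chart carries `S`'s OWN stacking word, so the S-side «sheet» sub-case of critic row 830 (a faulted `S` registered to a fault-free
chart) is not an inhabitant of [T_bᵇ]; the special doors [I_D] `DressedCorePG` / [CG] `ClampedCorePG` (parts UG, UH), the dressed half [D_w] and the
cuts of parts UE–UH are registration-free or Ψ-blind and are NOT re-typed.
No `sorry`, no new axiom, no instance / notation; ONE `set_option maxHeartbeats 800000 in` (inherited verbatim from part UB's glue); no literature claim beyond
those of parts UB, UC, UG.
-/

noncomputable section

open scoped BigOperators
open MeasureTheory Set Metric Filter Topology
open Summit.AtomisticToContinuum.Crystallization.Theorems.ChartedPlanarOrderRigidityDoor (E3 atomsIn)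
open Summit.AtomisticToContinuum.Crystallization.Theorems.ChartedPlanarOrderDensityDichotomy (μS IsSep nK nK_nonneg)
open Summit.AtomisticToContinuum.Crystallization.Theorems.ChartedPlanarOrderCleanScaleP (IsCleanP IsDoorSetP)
open Summit.AtomisticToContinuum.Crystallization.Theorems.ChartedPlanarOrderMesoCut (LayeredHom EnvClose)
open Summit.AtomisticToContinuum.Crystallization.Theorems.ChartedPlanarOrderDoorLayered (atomsIn_subset)
open Summit.AtomisticToContinuum.Crystallization.Theorems.ChartedPlanarOrderDoorLayeredOsc (IsTwoShellAffineGood)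
open Literature.Analysis.PDE (finavg ZatorskaGoldstein2005_localGehringLemmaCounting)

namespace Summit.AtomisticToContinuum.Crystallization.Theorems.ChartedZeroExcessLayeredLatticeLiouville

/-! ### ZK.1  The Gehring glue `[Cᵇ] ∧ leaf ⇒ (M♭ᵇ)₀ ⇒ (Mᵇ)` -/

set_option maxHeartbeats 800000 in
/-- ★★★ **GLUE (PROVED): `[Cᵇ] ∧ (local counting Gehring lemma) ⇒ (M♭ᵇ)₀`** — part UB's `strainSparsePG_zero_of_rigidCaccioppoliPG` VERBATIM ([Cᵇ] is
instantiated once, at the given bond-isomorphic `Ψ`; then the leaf at `(C_D, C₁, d, λ, σ₀) := (doorDoublingC δ, b, d, 2, 2)`, three doublings at the root,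
Chebyshev in `ℓ^{1+ε₁}` above `t₀`; thresholds `η₁ := min η₁^{[Cᵇ]} (Kε^{1/ε₁}/(C₃+1))`, `R₁ := max R₁^{[Cᵇ]} 12` as there). [this file, g52] -/
theorem strainSparseBPG_zero_of_rigidCaccioppoliBPG {aHi Λ θ s : ℝ} (haHi : aHi ≤ 8 / 7)
    (hG : ZatorskaGoldstein2005_localGehringLemmaCounting) (hC : RigidCaccioppoliBPG aHi Λ θ s) :
    StrainSparseBPG 0 aHi Λ θ s := by
  intro δ hδ a ha Cg hCg
  obtain ⟨Cg', hCg', b, hb, d, hd0, hd1, A, hA, hK⟩ := hC δ hδ a ha Cg hCg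
  refine ⟨Cg', hCg', ?_⟩
  intro t₀ _ ht₀ ε hε K₀ hK₀
  obtain ⟨C₂, ε₁, hε₁, hGe⟩ :=
    hG (doorDoublingC δ) b d 2 2 (one_le_doorDoublingC hδ) hb hd0 hd1 one_lt_two one_lt_two
  obtain ⟨η₁', hη₁', R₁', hR₁', hmain⟩ := hK K₀ hK₀
  -- the constants
  set D : ℝ := doorDoublingC δ with hDdef
  have hD1 : 1 ≤ D := one_le_doorDoublingC hδ
  have hD0 : 0 ≤ D := by linarith
  set c : ℝ := winDensC δ with hcdef
  have hc1 : 1 ≤ c := one_le_winDensC hδ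
  set C₂' : ℝ := max C₂ 1 with hC₂'def
  have hC₂'1 : 1 ≤ C₂' := le_max_right _ _
  have hC₂C₂' : C₂ ≤ C₂' := le_max_left _ _
  set C₃ : ℝ := C₂' * (A * (D ^ 3 + 1)) with hC₃def
  have hC₃0 : 0 ≤ C₃ := by positivity
  have hC₃1 : (0 : ℝ) < C₃ + 1 := by linarith
  set T : ℝ := (t₀ ^ 2) ^ ε₁ with hTdef
  have hT : 0 < T := Real.rpow_pos_of_pos (by positivity) _
  set Kε : ℝ := T * ε / (c ^ 2 * (C₃ + 1)) with hKεdef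
  have hKε : 0 < Kε := by positivity
  set ηs : ℝ := Kε ^ (1 / ε₁) / (C₃ + 1) with hηsdef
  have hηs : 0 < ηs := div_pos (Real.rpow_pos_of_pos hKε _) hC₃1
  refine ⟨min η₁' ηs, lt_min hη₁' hηs, max R₁' 12, lt_max_of_lt_left hR₁', ?_⟩
  intro S hS hgood η hη hηle R hR L w hLw Ψ hΨ hB hfat
  have hη₁ : η ≤ η₁' := hηle.trans (min_le_left _ _)
  have hηs' : η ≤ ηs := hηle.trans (min_le_right _ _)
  have hR₁ : R₁' ≤ R := (le_max_left _ _).trans hR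
  have hR12 : 12 ≤ R := (le_max_right _ _).trans hR
  obtain ⟨Ψ', hΨ', Q, σ, hd, hL2, hRH⟩ := hmain S hS hgood η hη hη₁ R hR₁ L w hLw Ψ hΨ hB hfat
  refine ⟨Ψ', hΨ', Q, σ, isTiltStrainData_of_radius_le (by linarith) hd, ?_⟩
  -- door-set data for the leaf
  have hsep : IsSep δ S := hS.1.2.1
  have hCl : IsCleanP aHi (μS S) := hS.1.2.2.1
  have h0S : (0 : E3) ∈ S := hS.1.1
  have hfin : ∀ (x : E3) (r : ℝ), (S ∩ ball x r).Finite := fun x r => finite_inter_ball_of_isSep hδ hsep x r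
  have hdoub : ∀ x ∈ S, ∀ r : ℝ, 0 < r →
      ((S ∩ ball x (2 * r)).ncard : ℝ) ≤ D * ((S ∩ ball x r).ncard : ℝ) :=
    fun x hx r hr => ncard_inter_ball_two_mul_le haHi hδ hsep hCl hx hr
  have hAη : 0 ≤ A * η := mul_nonneg hA hη.le
  -- the leaf's hypothesis = [C] (ii) with `g ≡ A η`
  have hhyp : ∀ x ∈ S, ∀ r : ℝ, 0 < r → S ∩ ball x (2 * r) ⊆ ball (0 : E3) (8 * R) →
      finavg (S ∩ ball x r) (fun y => σ y ^ 2) ≤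
        b * ((finavg (S ∩ ball x (2 * r)) (fun y => (fun y => σ y ^ 2) y ^ d)) ^ (1 / d) +
          finavg (S ∩ ball x (2 * r)) (fun _ => A * η)) := by
    intro x hx r hr hsub2
    have hne : (S ∩ ball x (2 * r)).Nonempty := ⟨x, hx, mem_ball_self (by linarith)⟩
    rw [finavg_const_of_finite (hfin x (2 * r)) hne]
    exact hRH x hx r hr hsub2
  have hsub0 : S ∩ ball (0 : E3) (2 * (R + 1)) ⊆ ball (0 : E3) (8 * R) := by
    intro p hp
    have h := mem_ball.1 hp.2
    exact mem_ball.2 (by linarith)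
  have hleaf := hGe E3 S hfin hdoub (ball (0 : E3) (8 * R)) isOpen_ball (fun y => σ y ^ 2) (fun _ => A * η)
    (fun x _ => sq_nonneg (σ x)) (fun _ _ => hAη) hhyp 0 h0S (R + 1) (by linarith) hsub0
  -- the two root balls
  set B₁ : Set E3 := S ∩ ball (0 : E3) (R + 1) with hB₁def
  set B₂ : Set E3 := S ∩ ball (0 : E3) (2 * (R + 1)) with hB₂def
  have hB₁fin : B₁.Finite := hfin 0 _
  have hB₂fin : B₂.Finite := hfin 0 _
  have hne1 : B₁.Nonempty := ⟨0, h0S, mem_ball_self (by linarith)⟩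
  have hne2 : B₂.Nonempty := ⟨0, h0S, mem_ball_self (by linarith)⟩
  have hB₁pos : (0 : ℝ) < (B₁.ncard : ℝ) := by exact_mod_cast (Set.ncard_pos hB₁fin).2 hne1
  have hB₂pos : (0 : ℝ) < (B₂.ncard : ℝ) := by exact_mod_cast (Set.ncard_pos hB₂fin).2 hne2
  have hgavg : (finavg B₂ (fun _ => (A * η) ^ (2 : ℝ))) ^ (1 / (2 : ℝ)) = A * η := by
    rw [finavg_const_of_finite hB₂fin hne2, one_div, Real.rpow_rpow_inv hAη two_ne_zero]
  rw [hgavg] at hleaf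
  -- `⨍_{B₂} σ² ≤ A η D³` by three doublings at the root and the L²-background (i)
  have hd1 := hdoub 0 h0S (2 * (R + 1)) (by linarith)
  have hd2 := hdoub 0 h0S (2 * (2 * (R + 1))) (by linarith)
  have hd3 := hdoub 0 h0S (2 * (2 * (2 * (R + 1)))) (by linarith)
  have hwin8 : atomsIn (μS S) 0 (8 * R) ⊆ S ∩ ball (0 : E3) (2 * (2 * (2 * (2 * (R + 1))))) := by
    intro p hp
    rcases mem_atomsIn_iff.1 hp with ⟨hpS, hpn⟩
    exact ⟨hpS, mem_ball.2 (by rw [dist_zero_right]; linarith)⟩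
  have hnK8 : nK (atomsIn (μS S) 0 (8 * R)) ≤ D ^ 3 * (B₂.ncard : ℝ) := by
    have h1 : nK (atomsIn (μS S) 0 (8 * R)) ≤ ((S ∩ ball (0 : E3) (2 * (2 * (2 * (2 * (R + 1)))))).ncard : ℝ) := by
      unfold nK
      exact_mod_cast Set.ncard_le_ncard hwin8 (hfin 0 _)
    calc nK (atomsIn (μS S) 0 (8 * R)) ≤ _ := h1
      _ ≤ D * ((S ∩ ball (0 : E3) (2 * (2 * (2 * (R + 1))))).ncard : ℝ) := hd3
      _ ≤ D * (D * ((S ∩ ball (0 : E3) (2 * (2 * (R + 1)))).ncard : ℝ)) := mul_le_mul_of_nonneg_left hd2 hD0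
      _ ≤ D * (D * (D * (B₂.ncard : ℝ))) := mul_le_mul_of_nonneg_left (mul_le_mul_of_nonneg_left hd1 hD0) hD0
      _ = D ^ 3 * (B₂.ncard : ℝ) := by ring
  have hsum2 : ∑ᶠ y ∈ B₂, σ y ^ 2 ≤ A * η * nK (atomsIn (μS S) 0 (8 * R)) := by
    have hB₂sub : B₂ ⊆ atomsIn (μS S) 0 (8 * R) := by
      intro p hp
      refine mem_atomsIn_iff.2 ⟨hp.1, ?_⟩
      have h := mem_ball.1 hp.2
      rw [dist_zero_right] at h
      linarith
    exact (finsum_mem_le_finsum_mem_of_subset_of_nonneg (finite_atomsIn hδ hsep _) hB₂sub (fun x _ => sq_nonneg (σ x))).trans hL2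
  have havg2 : finavg B₂ (fun y => σ y ^ 2) ≤ A * η * D ^ 3 := by
    unfold finavg
    rw [div_le_iff₀ hB₂pos]
    calc ∑ᶠ y ∈ B₂, σ y ^ 2 ≤ A * η * nK (atomsIn (μS S) 0 (8 * R)) := hsum2
      _ ≤ A * η * (D ^ 3 * (B₂.ncard : ℝ)) := mul_le_mul_of_nonneg_left hnK8 hAη
      _ = A * η * D ^ 3 * (B₂.ncard : ℝ) := by ring
  -- the mean of `F := (σ²)^{1+ε₁}` on `B₁`
  have hε₁1 : (0 : ℝ) < 1 + ε₁ := by linarith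
  have hFnn : ∀ y, 0 ≤ (σ y ^ 2) ^ (1 + ε₁) := fun y => Real.rpow_nonneg (sq_nonneg _) _
  have havgF_nn : 0 ≤ finavg B₁ (fun y => (σ y ^ 2) ^ (1 + ε₁)) := finavg_nonneg_of_nonneg hFnn
  have hM : (finavg B₁ (fun y => (σ y ^ 2) ^ (1 + ε₁))) ^ (1 / (1 + ε₁)) ≤ C₃ * η := by
    have h2 : finavg B₂ (fun y => σ y ^ 2) + A * η ≤ A * η * D ^ 3 + A * η := by linarith
    have h3 : 0 ≤ finavg B₂ (fun y => σ y ^ 2) + A * η := by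
      have := finavg_nonneg_of_nonneg (K := B₂) (fun y => sq_nonneg (σ y))
      linarith
    calc (finavg B₁ (fun y => (σ y ^ 2) ^ (1 + ε₁))) ^ (1 / (1 + ε₁))
        ≤ C₂ * (finavg B₂ (fun y => σ y ^ 2) + A * η) := hleaf
      _ ≤ C₂' * (finavg B₂ (fun y => σ y ^ 2) + A * η) := mul_le_mul_of_nonneg_right hC₂C₂' h3
      _ ≤ C₂' * (A * η * D ^ 3 + A * η) := mul_le_mul_of_nonneg_left h2 (by linarith)
      _ = C₃ * η := by rw [hC₃def]; ring
  have havgF : finavg B₁ (fun y => (σ y ^ 2) ^ (1 + ε₁)) ≤ (C₃ * η) ^ (1 + ε₁) := by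
    have h1 : finavg B₁ (fun y => (σ y ^ 2) ^ (1 + ε₁)) =
        ((finavg B₁ (fun y => (σ y ^ 2) ^ (1 + ε₁))) ^ (1 / (1 + ε₁))) ^ (1 + ε₁) := by
      rw [one_div, Real.rpow_inv_rpow havgF_nn hε₁1.ne']
    rw [h1]
    exact Real.rpow_le_rpow (Real.rpow_nonneg havgF_nn _) hM hε₁1.le
  have hsumF : ∑ᶠ y ∈ B₁, (σ y ^ 2) ^ (1 + ε₁) ≤ (B₁.ncard : ℝ) * (C₃ * η) ^ (1 + ε₁) := by
    rw [finsum_mem_eq_ncard_mul_finavg hB₁fin hne1]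
    exact mul_le_mul_of_nonneg_left havgF (Nat.cast_nonneg _)
  -- Chebyshev in `ℓ^{1+ε₁}` above the threshold `t₀`
  have hwin1 : atomsIn (μS S) 0 R ⊆ B₁ := by
    intro p hp
    rcases mem_atomsIn_iff.1 hp with ⟨hpS, hpn⟩
    exact ⟨hpS, mem_ball.2 (by rw [dist_zero_right]; linarith)⟩
  have hwinfin : (atomsIn (μS S) 0 R).Finite := hB₁fin.subset hwin1
  have hpt : ∀ x ∈ atomsIn (μS S) 0 R, T * (if t₀ ≤ σ x then σ x ^ 2 else 0) ≤ (σ x ^ 2) ^ (1 + ε₁) := by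
    intro x _
    split_ifs with hx
    · have ht2 : t₀ ^ 2 ≤ σ x ^ 2 := pow_le_pow_left₀ ht₀.le hx 2
      have h1 : T ≤ (σ x ^ 2) ^ ε₁ := Real.rpow_le_rpow (by positivity) ht2 hε₁.le
      calc T * σ x ^ 2 ≤ (σ x ^ 2) ^ ε₁ * σ x ^ 2 := mul_le_mul_of_nonneg_right h1 (sq_nonneg _)
        _ = (σ x ^ 2) ^ (1 + ε₁) := by
            rw [show (1 : ℝ) + ε₁ = ε₁ + 1 by ring, Real.rpow_add' (sq_nonneg _) (by linarith), Real.rpow_one]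
    · rw [mul_zero]; exact hFnn x
  have hmass : T * strainMassAbove t₀ (atomsIn (μS S) 0 R) σ ≤ (B₁.ncard : ℝ) * (C₃ * η) ^ (1 + ε₁) := by
    unfold strainMassAbove
    rw [← winsum_const_mul hwinfin]
    calc ∑ᶠ x ∈ atomsIn (μS S) 0 R, T * (if t₀ ≤ σ x then σ x ^ 2 else 0)
        ≤ ∑ᶠ x ∈ atomsIn (μS S) 0 R, (σ x ^ 2) ^ (1 + ε₁) := winsum_le_winsum_of_le hwinfin hpt
      _ ≤ ∑ᶠ x ∈ B₁, (σ x ^ 2) ^ (1 + ε₁) := finsum_mem_le_finsum_mem_of_subset_of_nonneg hB₁fin hwin1 (fun x _ => hFnn x)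
      _ ≤ (B₁.ncard : ℝ) * (C₃ * η) ^ (1 + ε₁) := hsumF
  -- counting: `#B₁ ≤ nK(win (R+4)) ≤ c²·nK(win R)`
  have hB₁count : (B₁.ncard : ℝ) ≤ c ^ 2 * nK (atomsIn (μS S) 0 R) := by
    have hsub : B₁ ⊆ atomsIn (μS S) 0 (R + 4) := by
      intro p hp
      refine mem_atomsIn_iff.2 ⟨hp.1, ?_⟩
      have h := mem_ball.1 hp.2
      rw [dist_zero_right] at h
      linarith
    calc (B₁.ncard : ℝ) ≤ nK (atomsIn (μS S) 0 (R + 4)) := by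
          unfold nK
          exact_mod_cast Set.ncard_le_ncard hsub (finite_atomsIn hδ hsep _)
      _ ≤ c ^ 2 * nK (atomsIn (μS S) 0 R) := nK_atomsIn_add_four_le haHi hδ hS.1 hR12
  -- smallness of `η^{ε₁}`
  have hC₃η : 0 ≤ C₃ * η := mul_nonneg hC₃0 hη.le
  have hpow : (C₃ * η) ^ (1 + ε₁) = C₃ * η * (C₃ * η) ^ ε₁ := by
    rw [Real.rpow_add' hC₃η (by linarith), Real.rpow_one]
  have hsmall : (C₃ * η) ^ ε₁ ≤ Kε := by
    have h1 : C₃ * η ≤ Kε ^ (1 / ε₁) := by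
      have h2 : C₃ * η ≤ (C₃ + 1) * ηs :=
        (mul_le_mul_of_nonneg_right (by linarith : C₃ ≤ C₃ + 1) hη.le).trans (mul_le_mul_of_nonneg_left hηs' hC₃1.le)
      have h3 : (C₃ + 1) * ηs = Kε ^ (1 / ε₁) := by
        rw [hηsdef, mul_comm, div_mul_cancel₀ _ hC₃1.ne']
      linarith
    calc (C₃ * η) ^ ε₁ ≤ (Kε ^ (1 / ε₁)) ^ ε₁ := Real.rpow_le_rpow hC₃η h1 hε₁.le
      _ = Kε := by rw [one_div, Real.rpow_inv_rpow hKε.le hε₁.ne']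
  -- conclusion
  have hnKnn : 0 ≤ nK (atomsIn (μS S) 0 R) := nK_nonneg _
  have hfinal : T * strainMassAbove t₀ (atomsIn (μS S) 0 R) σ ≤ T * (ε * η * nK (atomsIn (μS S) 0 R)) := by
    calc T * strainMassAbove t₀ (atomsIn (μS S) 0 R) σ ≤ (B₁.ncard : ℝ) * (C₃ * η) ^ (1 + ε₁) := hmass
      _ ≤ c ^ 2 * nK (atomsIn (μS S) 0 R) * (C₃ * η * Kε) := by
          rw [hpow]
          exact mul_le_mul hB₁count (mul_le_mul_of_nonneg_left hsmall hC₃η) (by positivity)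
            (mul_nonneg (sq_nonneg c) hnKnn)
      _ = T * (ε * η * nK (atomsIn (μS S) 0 R)) * (c ^ 2 * C₃ / (c ^ 2 * (C₃ + 1))) := by
          rw [hKεdef]; ring
      _ ≤ T * (ε * η * nK (atomsIn (μS S) 0 R)) * 1 := by
          apply mul_le_mul_of_nonneg_left _ (by positivity)
          rw [div_le_one (by positivity)]
          exact mul_le_mul_of_nonneg_left (by linarith) (sq_nonneg c)
      _ = T * (ε * η * nK (atomsIn (μS S) 0 R)) := mul_one _
  exact le_of_mul_le_mul_left hfinal hT

/-- ★★★ **COROLLARY (PROVED): `[Cᵇ] ∧ Gehring-leaf ⇒ (Mᵇ)`** — the (Mᵇ)-side seam of line `_16XH19B(_tol)`: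
`RigidCaccioppoliBPG aHi Λ θ s → ZatorskaGoldstein2005_localGehringLemmaCounting → StrainNonConcentrationBPG aHi Λ θ s` (`aHi ≤ 8/7`). [this file, g52] -/
theorem strainNonConcentrationBPG_of_rigidCaccioppoliBPG {aHi Λ θ s : ℝ} (haHi : aHi ≤ 8 / 7)
    (hG : ZatorskaGoldstein2005_localGehringLemmaCounting) (hC : RigidCaccioppoliBPG aHi Λ θ s) :
    StrainNonConcentrationBPG aHi Λ θ s :=
  strainNonConcentrationBPG_of_strainSparseBPG haHi (strainSparseBPG_zero_of_rigidCaccioppoliBPG haHi hG hC)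

/-- Record example at the line's literals `(aHi; Λ, θ, s) = (1; 2, 1/16, 1/50)`: [Cᵇ] and the leaf give the column's leaf (Mᵇ) of part UI. -/
example (hG : ZatorskaGoldstein2005_localGehringLemmaCounting) (hC : RigidCaccioppoliBPG 1 2 (1 / 16) (1 / 50)) :
    StrainNonConcentrationBPG 1 2 (1 / 16) (1 / 50) :=
  strainNonConcentrationBPG_of_rigidCaccioppoliBPG (by norm_num) hG hC

/-- Record example: the OLD generic residual still closes the new leaf ([C] ⇒ [Cᵇ] ⇒ (Mᵇ)) — nothing of parts UA/UB is lost. -/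
example (hG : ZatorskaGoldstein2005_localGehringLemmaCounting) (hC : RigidCaccioppoliPG 1 2 (1 / 16) (1 / 50)) :
    StrainNonConcentrationBPG 1 2 (1 / 16) (1 / 50) :=
  strainNonConcentrationBPG_of_rigidCaccioppoliBPG (by norm_num) hG (rigidCaccioppoliBPG_of_rigidCaccioppoliPG hC)

/-! ### ZK.2  [Tᵇ] «TameWindowBPG», [T_bᵇ] «BareTameWindowBPG», and the cut `[Tᵇ] ⟸ [I_D] ∧ [T_bᵇ]` -/

/-- ★★ **[Tᵇ] «TameWindowBPG ϑ aHi Λ θ s»** — [T] `TameWindowPG` (part UC) VERBATIM with the extra hypothesis `IsBondIso S Ψ` (part TG) on the GIVEN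
registration; conclusion unchanged (EVERY site of `win 9R` is `ϑ`-tame relative to the chart lattice).  WEAKER than [T] (`tameWindowBPG_of_tameWindowPG`);
cut `[Tᵇ] ⟸ [D_w] ∧ [T_bᵇ] ⟸ [I_D] ∧ [T_bᵇ]` PROVED below; consumed by part UL's `[Tᵇ] ∧ [C_Tᵇ] ⇒ [Cᵇ]`.  NEW · GSC-priced · UNDECIDED · INSTRUMENTABLE ((F0)
«HotStarScan», part UC).  Why it might fail: as [T] — a coherent, defect-free, self-equilibrated hot anomaly that no finite e⋆-replacement improves; under the
clause the chart carries `S`'s own stacking word, so relatively faulted charts and S-side sheets are not inhabitants.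
Sources: part UC ([T]: Ehrlacher–Ortner–Shapeev 2016; Theil 2006; Flatley–Theil, arXiv 1407.0692; E–Ming 2007); parts TG, UI; census TAG 174 (a⁗). [this file, g52] -/
def TameWindowBPG (ϑ aHi Λ θ s : ℝ) : Prop :=
  ∀ δ : ℝ, 0 < δ → ∀ a : ℝ, 0 < a → ∀ Cg : ℝ, 1 ≤ Cg → ∀ K₀ : ℝ, 0 < K₀ → ∃ η₁ : ℝ, 0 < η₁ ∧ ∃ R₁ : ℝ, 0 < R₁ ∧
    ∀ S : Set E3, IsDoorSetPG aHi δ S → (∀ q ∈ S, IsTwoShellAffineGood θ S q) →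
      ∀ η : ℝ, 0 < η → η ≤ η₁ → ∀ R : ℝ, R₁ ≤ R →
        ∀ (L : E3 ≃L[ℝ] E3) (w : ℤ → E3), IsEquilChart a s Λ L w →
          ∀ Ψ : E3 → E3, IsGlobalReg Cg η R S (LayeredHom (L : E3 →L[ℝ] E3) w) Ψ → IsBondIso S Ψ →
            K₀ ≤ η * nK (atomsIn (μS S) 0 R) →
              IsTameOn ϑ S (LayeredHom (L : E3 →L[ℝ] E3) w) (atomsIn (μS S) 0 (9 * R))

/-- ★★ **[T_bᵇ] «BareTameWindowBPG ϑ ϑe ωe p r₀ ℓ M aHi Λ θ s»** — [T_b] `BareTameWindowPG` (part UG, the [T]-side residual of record) VERBATIM with the extra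
hypothesis `IsBondIso S Ψ`; conclusion unchanged (every BARE site of `win 9R` is `ϑ`-tame).  WEAKER than [T_b] and than [Tᵇ] (PROVED); with the
registration-free special door it gives [Tᵇ] back (`tameWindowBPG_of_dressedCore_of_bare`, `tameWindowBPG_of_clampedCore_of_bare`).  THE [T]-SIDE RESIDUAL
OF RECORD of line `_16XH19B(_tol)`.  NEW · GSC-priced · UNDECIDED · INSTRUMENTABLE ((F0g) «DressScan») · IDEA-NEEDED (source chains) — and, under the clause,
free of the S-side SHEET sub-case of critic row 830 (a faulted `S` against a fault-free chart admits no bond-isomorphic registration).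
Why it might fail: as [T_b] — a self-equilibrated CHAIN of anomaly sources that no finite e⋆-replacement improves; none known, none seen in the census.
Sources: part UG ([T_b]); part UC ([T]); Braun–Hudson–Ortner, arXiv 2108.04765; parts TG, UI. [this file, g52] -/
def BareTameWindowBPG (ϑ ϑe ωe : ℝ) (p : ℕ) (r₀ ℓ : ℝ) (M : ℕ) (aHi Λ θ s : ℝ) : Prop :=
  ∀ δ : ℝ, 0 < δ → ∀ a : ℝ, 0 < a → ∀ Cg : ℝ, 1 ≤ Cg → ∀ K₀ : ℝ, 0 < K₀ → ∃ η₁ : ℝ, 0 < η₁ ∧ ∃ R₁ : ℝ, 0 < R₁ ∧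
    ∀ S : Set E3, IsDoorSetPG aHi δ S → (∀ q ∈ S, IsTwoShellAffineGood θ S q) →
      ∀ η : ℝ, 0 < η → η ≤ η₁ → ∀ R : ℝ, R₁ ≤ R →
        ∀ (L : E3 ≃L[ℝ] E3) (w : ℤ → E3), IsEquilChart a s Λ L w →
          ∀ Ψ : E3 → E3, IsGlobalReg Cg η R S (LayeredHom (L : E3 →L[ℝ] E3) w) Ψ → IsBondIso S Ψ →
            K₀ ≤ η * nK (atomsIn (μS S) 0 R) →
              ∀ x ∈ atomsIn (μS S) 0 (9 * R), ¬ IsDressed ϑe ωe p r₀ ℓ M S (LayeredHom (L : E3 →L[ℝ] E3) w) x →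
                IsTameStar ϑ S (LayeredHom (L : E3 →L[ℝ] E3) w) x

/-- **[T] ⇒ [Tᵇ] (PROVED)** — one more hypothesis. [this file, g52] -/
theorem tameWindowBPG_of_tameWindowPG {ϑ aHi Λ θ s : ℝ} (h : TameWindowPG ϑ aHi Λ θ s) : TameWindowBPG ϑ aHi Λ θ s := by
  intro δ hδ a ha Cg hCg K₀ hK₀
  obtain ⟨η₁, hη₁, R₁, hR₁, h1⟩ := h δ hδ a ha Cg hCg K₀ hK₀
  exact ⟨η₁, hη₁, R₁, hR₁, fun S hS hgood η hη hηle R hR L w hLw Ψ hΨ _ hfat => h1 S hS hgood η hη hηle R hR L w hLw Ψ hΨ hfat⟩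

/-- **[T_b] ⇒ [T_bᵇ] (PROVED)** — one more hypothesis. [this file, g52] -/
theorem bareTameWindowBPG_of_bareTameWindowPG {ϑ ϑe ωe : ℝ} {p : ℕ} {r₀ ℓ : ℝ} {M : ℕ} {aHi Λ θ s : ℝ}
    (h : BareTameWindowPG ϑ ϑe ωe p r₀ ℓ M aHi Λ θ s) : BareTameWindowBPG ϑ ϑe ωe p r₀ ℓ M aHi Λ θ s := by
  intro δ hδ a ha Cg hCg K₀ hK₀
  obtain ⟨η₁, hη₁, R₁, hR₁, h1⟩ := h δ hδ a ha Cg hCg K₀ hK₀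
  exact ⟨η₁, hη₁, R₁, hR₁, fun S hS hgood η hη hηle R hR L w hLw Ψ hΨ _ hfat x hx hnd =>
    h1 S hS hgood η hη hηle R hR L w hLw Ψ hΨ hfat x hx hnd⟩

/-- **[Tᵇ] ⇒ [T_bᵇ] (PROVED)** — the bare residual is WEAKER than [Tᵇ]. [this file, g52] -/
theorem bareTameWindowBPG_of_tameWindowBPG {ϑ ϑe ωe : ℝ} {p : ℕ} {r₀ ℓ : ℝ} {M : ℕ} {aHi Λ θ s : ℝ} (h : TameWindowBPG ϑ aHi Λ θ s) :
    BareTameWindowBPG ϑ ϑe ωe p r₀ ℓ M aHi Λ θ s := by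
  intro δ hδ a ha Cg hCg K₀ hK₀
  obtain ⟨η₁, hη₁, R₁, hR₁, h1⟩ := h δ hδ a ha Cg hCg K₀ hK₀
  exact ⟨η₁, hη₁, R₁, hR₁, fun S hS hgood η hη hηle R hR L w hLw Ψ hΨ hBI hfat x hx _ =>
    h1 S hS hgood η hη hηle R hR L w hLw Ψ hΨ hBI hfat x hx⟩

/-- ★★★ **SEAM (PROVED): `[D_w] ∧ [T_bᵇ] ⇒ [Tᵇ]`** — part UG's exhaustive dichotomy (`em` on `IsDressed`), the clause handed to
[T_bᵇ] only ([D_w] `DressedTameWindowPG` needs none); `η₁ := min`, `R₁ := max`. [this file, g52] -/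
theorem tameWindowBPG_of_dressedTameWindow_of_bare {ϑ ϑe ωe : ℝ} {p : ℕ} {r₀ ℓ : ℝ} {M : ℕ} {aHi Λ θ s : ℝ}
    (hD : DressedTameWindowPG ϑ ϑe ωe p r₀ ℓ M aHi Λ θ s) (hTb : BareTameWindowBPG ϑ ϑe ωe p r₀ ℓ M aHi Λ θ s) :
    TameWindowBPG ϑ aHi Λ θ s := by
  intro δ hδ a ha Cg hCg K₀ hK₀
  obtain ⟨η₁, hη₁, R₁, hR₁, h1⟩ := hD δ hδ a ha Cg hCg K₀ hK₀
  obtain ⟨η₁', hη₁', R₁', hR₁', h2⟩ := hTb δ hδ a ha Cg hCg K₀ hK₀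
  refine ⟨min η₁ η₁', lt_min hη₁ hη₁', max R₁ R₁', lt_max_of_lt_left hR₁, ?_⟩
  intro S hS hgood η hη hηle R hR L w hLw Ψ hΨ hBI hfat x hx
  by_cases hd : IsDressed ϑe ωe p r₀ ℓ M S (LayeredHom (L : E3 →L[ℝ] E3) w) x
  · exact h1 S hS hgood η hη (hηle.trans (min_le_left _ _)) R ((le_max_left _ _).trans hR) L w hLw Ψ hΨ hfat x hx hd
  · exact h2 S hS hgood η hη (hηle.trans (min_le_right _ _)) R ((le_max_right _ _).trans hR) L w hLw Ψ hΨ hBI hfat x hx hd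

/-- ★★★ **SEAM (PROVED): `[I_D] ∧ [T_bᵇ] ⇒ [Tᵇ]`** — the registration-free special door of part UG and the re-typed residual. [this file, g52] -/
theorem tameWindowBPG_of_dressedCore_of_bare {ϑ ϑe ωe : ℝ} {p : ℕ} {r₀ ℓ : ℝ} {M : ℕ} {aHi Λ θ s : ℝ}
    (hI : DressedCorePG ϑ ϑe ωe p r₀ ℓ M aHi Λ θ s) (hTb : BareTameWindowBPG ϑ ϑe ωe p r₀ ℓ M aHi Λ θ s) : TameWindowBPG ϑ aHi Λ θ s :=
  tameWindowBPG_of_dressedTameWindow_of_bare (dressedTameWindowPG_of_dressedCorePG hI) hTb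

/-- **`[CG] ∧ [T_bᵇ] ⇒ [Tᵇ]` (PROVED, every clamp radius `ρ`)** — through part UH's `dressedCorePG_of_clampedCorePG`. [this file, g52] -/
theorem tameWindowBPG_of_clampedCore_of_bare {ϑ ϑe ωe : ℝ} {p : ℕ} {r₀ ℓ : ℝ} {M : ℕ} {ρ aHi Λ θ s : ℝ}
    (hI : ClampedCorePG ϑ ϑe ωe p r₀ ℓ M ρ aHi Λ θ s) (hTb : BareTameWindowBPG ϑ ϑe ωe p r₀ ℓ M aHi Λ θ s) : TameWindowBPG ϑ aHi Λ θ s :=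
  tameWindowBPG_of_dressedCore_of_bare (dressedCorePG_of_clampedCorePG hI) hTb

/-- Record example: the OLD [T]-side residual [T_b] with the door [I_D] gives the NEW [Tᵇ] at the literals of record. -/
example (hI : DressedCorePG tameRadius dressLevel dressLevel dressExponent 8 collarRadius clusterSize 1 2 (1 / 16) (1 / 50))
    (hTb : BareTameWindowPG tameRadius dressLevel dressLevel dressExponent 8 collarRadius clusterSize 1 2 (1 / 16) (1 / 50)) :
    TameWindowBPG tameRadius 1 2 (1 / 16) (1 / 50) :=
  tameWindowBPG_of_dressedCore_of_bare hI (bareTameWindowBPG_of_bareTameWindowPG hTb)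

end Summit.AtomisticToContinuum.Crystallization.Theorems.ChartedZeroExcessLayeredLatticeLiouville

end
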